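import Summits.Schanuel.Schanuel.Theorems.RootDecomp1KHyper44

/-!
# RootDecomp1KHyper — lens 6, generation 15 ADDENDUM 4 «UNIFORM n-PARAMETRIC ANCHORED THEOREM» (MeasuredAnchors.lean d7ef80c6…, 1059 l) — continuation (RootDecomp1KHyper45): §C main (section `AnchorsMain`): `hyperPolyApprox_of_anchors` (k-ary weak Lemma L + transfer; one proof)

(lens-6 g15 ADDENDUM 4 `MeasuredAnchors.lean`, sha256 d7ef80c6…6d97, own farm rc 0 · 0 sorry · axioms std; critic VERDICT STATUS L1634 (K-R18 MET; PORT GO (e)),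
CENSUS-REQUEST L1629; port by census-1 gen 15 in five parts RootDecomp1KHyper42–46; statements and proofs verbatim, one-line docstrings added,
generic one-liners / twins of landed lemmas made `private` with per-part private copies; `--supports stmt-Schanuel-33363`, no census credit.
Nothing here proves Schanuel; rung 0.)
-/

open Complex IntermediateField Polynomial

namespace Summit.Schanuel.Schanuel.Theorems.RootDecomp1KHyper

namespace HyperCell

/-- `u · exp(−u) ≤ 1` for `u ≥ 0`. -/
private theorem mul_exp_neg_le_one {u : ℝ} (_hu : 0 ≤ u) : u * Real.exp (-u) ≤ 1 := by
  have h := Real.add_one_le_exp u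
  rw [Real.exp_neg, mul_inv_le_iff₀ (Real.exp_pos _)]
  linarith

section AnchorsMain

variable {k : ℕ}

/-- **k-ary weak Lemma L + transfer.**  Let `z : Fin (k+1) → ℂ` be ℚ-free and `HyperLinLiouville`,
`θ` weakly measured, `W_l(θ) = q(θ) · v_l` with `v_l = a_l · z ∈ span_ℤ(z)` (`W` polynomially
independent, `q(θ) ≠ 0`), and let `z_j ∉ span_ℚ(v)`.  Then `q(θ) z_j` is hyper-polynomially
approximable over `θ` in degree `≤ d` (`d ≥ deg W_l`).  (Siegel's lemma supplies, level by level, an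
integer relation `Σ t_l v_l + th ε + te z_j = 0` with coefficients polynomial in `|h|`; the k-ary weak
lattice bound kills `te = 0`, the choice of `j` kills `th = 0`.) -/
theorem hyperPolyApprox_of_anchors {z : Fin (k + 1) → ℂ} (hz : LinearIndependent ℚ z)
    (hH : HyperLinLiouville z) {θ : Fin k → ℂ} (hθ : MvWeakMeasure θ)
    (W : Fin k → MvPolynomial (Fin k) ℤ) (q : MvPolynomial (Fin k) ℤ)
    (hq : MvPolynomial.aeval θ q ≠ 0)
    (hW : ∀ U : Fin k → ℤ, U ≠ 0 → ∑ l, MvPolynomial.C (U l) * W l ≠ 0)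
    (a : Fin k → Fin (k + 1) → ℤ)
    (hv : ∀ l, MvPolynomial.aeval θ q * (∑ i, (a l i : ℂ) * z i) = MvPolynomial.aeval θ (W l))
    {j : Fin (k + 1)}
    (hj : z j ∉ Submodule.span ℚ (Set.range fun l => ∑ i, (a l i : ℂ) * z i))
    {d : ℕ} (hWd : ∀ l, (W l).totalDegree ≤ d) :
    HyperPolyApprox θ d (MvPolynomial.aeval θ q * z j) := by
  classical
  have hcq0 : 0 < ‖MvPolynomial.aeval θ q‖ := norm_pos_iff.mpr hq
  obtain ⟨Cw, kw, hCw, hweak⟩ := weakLatLBk_of_mvWeakMeasure hθ W hW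
  have hl0 : ∀ l, (0 : ℝ) ≤ ((mvlen (W l) : ℤ) : ℝ) := fun l => by exact_mod_cast mvlen_nonneg _
  obtain ⟨Λ', hΛ'⟩ : ∃ Λ' : ℝ, Λ' = ∑ l, ((mvlen (W l) : ℤ) : ℝ) := ⟨_, rfl⟩
  have hΛ0 : 0 ≤ Λ' := by rw [hΛ']; exact Finset.sum_nonneg fun l _ => hl0 l
  have hk2 : (2 : ℝ) ≤ ((k + 2 : ℕ) : ℝ) := by exact_mod_cast (by omega : 2 ≤ k + 2)
  obtain ⟨κ, hκ⟩ : ∃ κ : ℝ, κ = ((k + 2 : ℕ) : ℝ) * (2 + amax a) := ⟨_, rfl⟩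
  have hκ1 : 1 ≤ κ := by rw [hκ]; nlinarith [amax_nonneg a]
  have hκ0 : 0 ≤ κ := by linarith
  obtain ⟨c₃, hc₃⟩ : ∃ c₃ : ℝ, c₃ = (2 + Λ') * κ ^ (2 * (k + 1)) := ⟨_, rfl⟩
  obtain ⟨cA, hcA⟩ : ∃ cA : ℝ, cA = ‖MvPolynomial.aeval θ q‖ * κ ^ (k + 1) := ⟨_, rfl⟩
  obtain ⟨cB, hcB⟩ : ∃ cB : ℝ, cB = Cw * (((k : ℝ) + 1) * κ ^ (k + 1)) ^ kw := ⟨_, rfl⟩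
  have hc₃0 : 0 ≤ c₃ := by rw [hc₃]; positivity
  have hcA0 : 0 ≤ cA := by rw [hcA]; positivity
  have hcB0 : 0 ≤ cB := by rw [hcB]; positivity
  intro m
  obtain ⟨T, hT⟩ := exists_le_two_pow (c₃ ^ m + cA + cB)
  obtain ⟨h, hh0, hsmall⟩ := hH (2 * (k + 1) * m + (k + 1) + (k + 1) * kw + T)
  obtain ⟨t, th, te, hne, hrel, htB, hthB, hteB⟩ := exists_siegel_relation a h j
  have hrelC := relation_eval (z := z) a h j hrel
  -- the base `X` and the small value `ε`
  obtain ⟨X, hX⟩ : ∃ X : ℝ, X = 1 + ∑ i, |(h i : ℝ)| := ⟨_, rfl⟩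
  have hX2 : 2 ≤ X := by have := one_le_hsum hh0; rw [hX]; linarith
  have hX1 : 1 ≤ X := by linarith
  have hX0 : 0 ≤ X := by linarith
  obtain ⟨ε, hε⟩ : ∃ ε : ℂ, ε = ∑ i, (h i : ℂ) * z i := ⟨_, rfl⟩
  have hε0 : ε ≠ 0 := by rw [hε]; exact form_ne_zero_of_linearIndependent hz hh0
  have hεlt : ‖ε‖ < Real.exp (-(X ^ (2 * (k + 1) * m + (k + 1) + (k + 1) * kw + T))) := by
    rw [hε, hX]; exact hsmall
  rw [← hε] at hrelC
  -- the Siegel bound in terms of `X`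
  obtain ⟨Bnd, hBnd⟩ : ∃ Bnd : ℝ,
      Bnd = (((k + 2 : ℕ) : ℝ) * (1 + amax a + ∑ i, |(h i : ℝ)|)) ^ (k + 1) := ⟨_, rfl⟩
  rw [← hBnd] at htB hthB hteB
  have hS0 : 0 ≤ ∑ i, |(h i : ℝ)| := Finset.sum_nonneg fun _ _ => abs_nonneg _
  have hBndX : Bnd ≤ (κ * X) ^ (k + 1) := by
    rw [hBnd]
    apply pow_le_pow_left₀ (mul_nonneg (by linarith) (by linarith [amax_nonneg a]))
    rw [hκ, hX, mul_assoc]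
    apply mul_le_mul_of_nonneg_left _ (by linarith)
    nlinarith [amax_nonneg a]
  have hBnd1 : 1 ≤ Bnd := by
    rw [hBnd]; apply one_le_pow₀
    nlinarith [amax_nonneg a]
  have hBnd0 : 0 < Bnd := by linarith
  have hκX0 : 0 ≤ (κ * X) ^ (k + 1) := pow_nonneg (mul_nonneg hκ0 hX0) _
  -- `Σ t_l W_l(θ) = q(θ) Σ t_l v_l`
  have hSw : ∑ l, (t l : ℂ) * MvPolynomial.aeval θ (W l) =
      MvPolynomial.aeval θ q * ∑ l, (t l : ℂ) * ∑ i, (a l i : ℂ) * z i := by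
    rw [Finset.mul_sum]
    exact Finset.sum_congr rfl fun l _ => by rw [← hv l]; ring
  rcases eq_or_ne te 0 with hte | hte
  · exfalso
    rcases eq_or_ne th 0 with hth | hth
    · -- `t ≠ 0` and `Σ t_l v_l = 0`: contradicts the polynomial independence of `W`
      have ht0 : t ≠ 0 := by
        rcases hne with h1 | h1 | h1
        · exact h1
        · exact absurd hth h1
        · exact absurd hte h1
      have hsum0 : ∑ l, (t l : ℂ) * ∑ i, (a l i : ℂ) * z i = 0 := by
        have := hrelC
        simp only [hte, hth, Int.cast_zero, zero_mul, add_zero] at this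
        exact this
      have hS0 : MvPolynomial.aeval θ (∑ l, MvPolynomial.C (t l) * W l) = 0 := by
        rw [aeval_S, hSw, hsum0, mul_zero]
      exact mvaeval_ne_zero_of_mvWeakMeasure hθ (hW t ht0) hS0
    · rcases eq_or_ne t 0 with ht0 | ht0
      · have h1 : (th : ℂ) * ε = 0 := by
          have := hrelC
          simp only [hte, ht0, Pi.zero_apply, Int.cast_zero, zero_mul, Finset.sum_const_zero,
            zero_add, add_zero] at this
          exact this
        rcases mul_eq_zero.mp h1 with h2 | h2
        · exact hth (by exact_mod_cast h2)
        · exact hε0 h2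
      · -- the weak lattice bound against the smallness of `ε`
        have hrel2 : ∑ l, (t l : ℂ) * MvPolynomial.aeval θ (W l) =
            -(MvPolynomial.aeval θ q * ((th : ℂ) * ε)) := by
          have e1 : ∑ l, (t l : ℂ) * ∑ i, (a l i : ℂ) * z i = -((th : ℂ) * ε) := by
            have := hrelC
            simp only [hte, Int.cast_zero, zero_mul, add_zero] at this
            linear_combination this
          rw [hSw, e1, mul_neg]
        have hlow := hweak t ht0
        rw [hrel2, norm_neg, norm_mul, norm_mul, Complex.norm_intCast] at hlow
        have ht00 : 0 ≤ ∑ l, |(t l : ℝ)| := Finset.sum_nonneg fun _ _ => abs_nonneg _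
        have htsum : 1 + ∑ l, |(t l : ℝ)| ≤ ((k : ℝ) + 1) * (κ * X) ^ (k + 1) := by
          have h1 : ∑ l, |(t l : ℝ)| ≤ ∑ _l : Fin k, Bnd := Finset.sum_le_sum fun l _ => htB l
          rw [Finset.sum_const, Finset.card_univ, Fintype.card_fin, nsmul_eq_mul] at h1
          have h2 : 1 ≤ (κ * X) ^ (k + 1) := one_le_pow₀ (by nlinarith)
          nlinarith [hBndX, (Nat.cast_nonneg k : (0 : ℝ) ≤ k)]
        have hpow : Cw * (1 + ∑ l, |(t l : ℝ)|) ^ kw ≤ cB * X ^ ((k + 1) * kw) := by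
          calc Cw * (1 + ∑ l, |(t l : ℝ)|) ^ kw
              ≤ Cw * (((k : ℝ) + 1) * (κ * X) ^ (k + 1)) ^ kw :=
                mul_le_mul_of_nonneg_left (pow_le_pow_left₀ (by linarith) htsum kw) hCw.le
            _ = cB * X ^ ((k + 1) * kw) := by
                rw [hcB, mul_pow κ X (k + 1), ← mul_assoc,
                  mul_pow (((k : ℝ) + 1) * κ ^ (k + 1)) (X ^ (k + 1)) kw, ← pow_mul]; ring
        have hlevel : cB * X ^ ((k + 1) * kw) + cA * X ^ (k + 1) ≤
            X ^ (2 * (k + 1) * m + (k + 1) + (k + 1) * kw + T) := by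
          have := level_helper hX2 hcB0 hcA0 ((k + 1) * kw) (k + 1) (2 * (k + 1) * m) T
            (by linarith [pow_nonneg hc₃0 m])
          have e : (k + 1) * kw + (k + 1) + 2 * (k + 1) * m + T =
              2 * (k + 1) * m + (k + 1) + (k + 1) * kw + T := by ring
          rw [e] at this; exact this
        have hchain : Real.exp (-(cB * X ^ ((k + 1) * kw))) <
            Real.exp (-(cB * X ^ ((k + 1) * kw))) := by
          calc Real.exp (-(cB * X ^ ((k + 1) * kw)))
              ≤ Real.exp (-(Cw * (1 + ∑ l, |(t l : ℝ)|) ^ kw)) :=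
                Real.exp_le_exp.mpr (neg_le_neg hpow)
            _ ≤ ‖MvPolynomial.aeval θ q‖ * (|(th : ℝ)| * ‖ε‖) := hlow
            _ ≤ ‖MvPolynomial.aeval θ q‖ * (Bnd * ‖ε‖) :=
                mul_le_mul_of_nonneg_left (mul_le_mul_of_nonneg_right hthB (norm_nonneg _))
                  (norm_nonneg _)
            _ < ‖MvPolynomial.aeval θ q‖ *
                  (Bnd * Real.exp (-(X ^ (2 * (k + 1) * m + (k + 1) + (k + 1) * kw + T)))) :=
                mul_lt_mul_of_pos_left (mul_lt_mul_of_pos_left hεlt hBnd0) hcq0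
            _ ≤ ‖MvPolynomial.aeval θ q‖ * ((κ * X) ^ (k + 1) *
                  Real.exp (-(cB * X ^ ((k + 1) * kw) + cA * X ^ (k + 1)))) :=
                mul_le_mul_of_nonneg_left (mul_le_mul hBndX
                  (Real.exp_le_exp.mpr (neg_le_neg hlevel)) (Real.exp_pos _).le hκX0)
                  (norm_nonneg _)
            _ = (cA * X ^ (k + 1) * Real.exp (-(cA * X ^ (k + 1)))) *
                  Real.exp (-(cB * X ^ ((k + 1) * kw))) := by
                rw [hcA, neg_add, Real.exp_add, mul_pow]; ring
            _ ≤ 1 * Real.exp (-(cB * X ^ ((k + 1) * kw))) :=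
                mul_le_mul_of_nonneg_right
                  (mul_exp_neg_le_one (mul_nonneg hcA0 (pow_nonneg hX0 _))) (Real.exp_pos _).le
            _ = Real.exp (-(cB * X ^ ((k + 1) * kw))) := one_mul _
        exact lt_irrefl _ hchain
  · have hteC : (te : ℂ) ≠ 0 := by exact_mod_cast hte
    rcases eq_or_ne th 0 with hth | hth
    · -- `te z_j = -Σ t_l v_l`: `z_j ∈ span_ℚ(v)`, excluded by the choice of `j`
      exfalso
      apply hj
      have e1 : (te : ℂ) * z j = -∑ l, (t l : ℂ) * ∑ i, (a l i : ℂ) * z i := by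
        have := hrelC
        simp only [hth, Int.cast_zero, zero_mul, add_zero] at this
        linear_combination this
      have e2 : z j = ∑ l, (((-(t l : ℚ)) / (te : ℚ) : ℚ) : ℂ) * (∑ i, (a l i : ℂ) * z i) := by
        apply mul_left_cancel₀ hteC
        rw [e1, Finset.mul_sum, ← Finset.sum_neg_distrib]
        refine Finset.sum_congr rfl fun l _ => ?_
        push_cast
        field_simp
      rw [e2]
      refine Submodule.sum_mem _ fun l _ => ?_
      rw [← Rat.smul_def]
      exact Submodule.smul_mem _ _ (Submodule.subset_span (Set.mem_range_self l))
    · -- the approximation `P/E`, `P = -(te · Σ t_l W_l)`, `E = te²`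
      obtain ⟨S, hS⟩ : ∃ S : MvPolynomial (Fin k) ℤ, S = ∑ l, MvPolynomial.C (t l) * W l :=
        ⟨_, rfl⟩
      have haS : MvPolynomial.aeval θ S = ∑ l, (t l : ℂ) * MvPolynomial.aeval θ (W l) := by
        rw [hS]; exact aeval_S θ W t
      have haP : MvPolynomial.aeval θ (-(MvPolynomial.C te * S)) =
          -((te : ℂ) * ∑ l, (t l : ℂ) * MvPolynomial.aeval θ (W l)) := by
        rw [map_neg, map_mul, haS]
        congr 2
        simp
      obtain ⟨E, hE⟩ : ∃ E : ℕ, (E : ℤ) = te ^ 2 :=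
        ⟨(te ^ 2).toNat, Int.toNat_of_nonneg (sq_nonneg te)⟩
      have hEC : (E : ℂ) = (te : ℂ) ^ 2 := by exact_mod_cast congrArg (Int.cast : ℤ → ℂ) hE
      have hER : (E : ℝ) = (te : ℝ) ^ 2 := by exact_mod_cast congrArg (Int.cast : ℤ → ℝ) hE
      have hE0 : 0 < E := by
        have h1 : (0 : ℤ) < E := by rw [hE]; positivity
        exact_mod_cast h1
      have hSv : ∑ l, (t l : ℂ) * ∑ i, (a l i : ℂ) * z i = -((th : ℂ) * ε) - (te : ℂ) * z j := by
        linear_combination hrelC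
      have hdiff : MvPolynomial.aeval θ q * z j -
          MvPolynomial.aeval θ (-(MvPolynomial.C te * S)) / (E : ℂ) =
            -(MvPolynomial.aeval θ q * (th : ℂ) * ε / (te : ℂ)) := by
        rw [haP, hEC, hSw, hSv]
        field_simp
        ring
      refine ⟨-(MvPolynomial.C te * S), E, hE0, ?_, ?_, ?_⟩
      · rw [MvPolynomial.totalDegree_neg]
        refine (MvPolynomial.totalDegree_mul _ _).trans ?_
        rw [MvPolynomial.totalDegree_C, zero_add, hS]
        exact totalDegree_S_le W hWd t
      · intro heq
        have h0 := sub_eq_zero.mpr heq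
        rw [hdiff, neg_eq_zero, div_eq_zero_iff, mul_eq_zero, mul_eq_zero] at h0
        rcases h0 with ((h1 | h1) | h1) | h1
        · exact hq h1
        · exact hth (by exact_mod_cast h1)
        · exact hε0 h1
        · exact hte (by exact_mod_cast h1)
      · rw [hdiff, norm_neg, norm_div, norm_mul, norm_mul, Complex.norm_intCast,
          Complex.norm_intCast]
        have hte1 : (1 : ℝ) ≤ |(te : ℝ)| := by exact_mod_cast Int.one_le_abs hte
        have hlenP0 : (0 : ℝ) ≤ ((mvlen (-(MvPolynomial.C te * S)) : ℤ) : ℝ) := by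
          exact_mod_cast mvlen_nonneg _
        have hY : 1 + (E : ℝ) + ((mvlen (-(MvPolynomial.C te * S)) : ℤ) : ℝ) ≤
            c₃ * X ^ (2 * (k + 1)) := by
          rw [hER, mvlen_neg]
          have hlenP : ((mvlen (MvPolynomial.C te * S) : ℤ) : ℝ) ≤ Bnd * (Bnd * Λ') := by
            have h1 : ((mvlen (MvPolynomial.C te * S) : ℤ) : ℝ) ≤ ((|te| * mvlen S : ℤ) : ℝ) := by
              exact_mod_cast mvlen_C_mul_le te S
            have h2 : ((mvlen S : ℤ) : ℝ) ≤ ((∑ l, |t l| * mvlen (W l) : ℤ) : ℝ) := by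
              rw [hS]; exact_mod_cast mvlen_S_le W t
            have h3 : ((∑ l, |t l| * mvlen (W l) : ℤ) : ℝ) ≤ Bnd * Λ' := by
              push_cast
              rw [hΛ', Finset.mul_sum]
              exact Finset.sum_le_sum fun l _ => mul_le_mul_of_nonneg_right (htB l) (hl0 l)
            have h4 : (0 : ℝ) ≤ ((mvlen S : ℤ) : ℝ) := by exact_mod_cast mvlen_nonneg _
            push_cast at h1
            calc ((mvlen (MvPolynomial.C te * S) : ℤ) : ℝ) ≤ |(te : ℝ)| * ((mvlen S : ℤ) : ℝ) := h1
              _ ≤ Bnd * (Bnd * Λ') := mul_le_mul hteB (h2.trans h3) h4 hBnd0.le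
          have hsq : (te : ℝ) ^ 2 ≤ Bnd ^ 2 := by
            rw [← sq_abs]; exact pow_le_pow_left₀ (abs_nonneg _) hteB 2
          have hB2 : Bnd ^ 2 ≤ (κ * X) ^ (2 * (k + 1)) := by
            have e : (κ * X) ^ (2 * (k + 1)) = ((κ * X) ^ (k + 1)) ^ 2 := by
              rw [mul_comm 2 (k + 1), pow_mul]
            rw [e]; exact pow_le_pow_left₀ hBnd0.le hBndX 2
          have hB1' : 1 ≤ Bnd ^ 2 := one_le_pow₀ hBnd1
          have e5 : Bnd * (Bnd * Λ') = Bnd ^ 2 * Λ' := by ring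
          rw [e5] at hlenP
          have e6 : (2 + Λ') * Bnd ^ 2 = Bnd ^ 2 + Bnd ^ 2 + Bnd ^ 2 * Λ' := by ring
          calc 1 + (te : ℝ) ^ 2 + ((mvlen (MvPolynomial.C te * S) : ℤ) : ℝ)
              ≤ 1 + Bnd ^ 2 + Bnd ^ 2 * Λ' := by linarith
            _ ≤ (2 + Λ') * Bnd ^ 2 := by rw [e6]; linarith
            _ ≤ (2 + Λ') * (κ * X) ^ (2 * (k + 1)) :=
                mul_le_mul_of_nonneg_left hB2 (by linarith)
            _ = c₃ * X ^ (2 * (k + 1)) := by rw [hc₃, mul_pow]; ring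
        have hY0 : 0 ≤ 1 + (E : ℝ) +
            ((mvlen (-(MvPolynomial.C te * S)) : ℤ) : ℝ) := by positivity
        have hYm : (1 + (E : ℝ) +
            ((mvlen (-(MvPolynomial.C te * S)) : ℤ) : ℝ)) ^ m ≤ c₃ ^ m * X ^ (2 * (k + 1) * m) := by
          calc _ ≤ (c₃ * X ^ (2 * (k + 1))) ^ m := pow_le_pow_left₀ hY0 hY m
            _ = c₃ ^ m * X ^ (2 * (k + 1) * m) := by rw [mul_pow, ← pow_mul]
        have hlevel : c₃ ^ m * X ^ (2 * (k + 1) * m) + cA * X ^ (k + 1) ≤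
            X ^ (2 * (k + 1) * m + (k + 1) + (k + 1) * kw + T) :=
          level_helper hX2 (pow_nonneg hc₃0 m) hcA0 (2 * (k + 1) * m) (k + 1) ((k + 1) * kw) T
            (by linarith)
        calc ‖MvPolynomial.aeval θ q‖ * |(th : ℝ)| * ‖ε‖ / |(te : ℝ)|
            ≤ ‖MvPolynomial.aeval θ q‖ * |(th : ℝ)| * ‖ε‖ := div_le_self (by positivity) hte1
          _ ≤ ‖MvPolynomial.aeval θ q‖ * Bnd * ‖ε‖ :=
              mul_le_mul_of_nonneg_right (mul_le_mul_of_nonneg_left hthB (norm_nonneg _))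
                (norm_nonneg _)
          _ < ‖MvPolynomial.aeval θ q‖ * Bnd *
                Real.exp (-(X ^ (2 * (k + 1) * m + (k + 1) + (k + 1) * kw + T))) :=
              mul_lt_mul_of_pos_left hεlt (mul_pos hcq0 hBnd0)
          _ ≤ ‖MvPolynomial.aeval θ q‖ * (κ * X) ^ (k + 1) *
                Real.exp (-(c₃ ^ m * X ^ (2 * (k + 1) * m) + cA * X ^ (k + 1))) :=
              mul_le_mul (mul_le_mul_of_nonneg_left hBndX (norm_nonneg _))
                (Real.exp_le_exp.mpr (neg_le_neg hlevel)) (Real.exp_pos _).le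
                (mul_nonneg (norm_nonneg _) hκX0)
          _ = (cA * X ^ (k + 1) * Real.exp (-(cA * X ^ (k + 1)))) *
                Real.exp (-(c₃ ^ m * X ^ (2 * (k + 1) * m))) := by
              rw [hcA, neg_add, Real.exp_add, mul_pow]; ring
          _ ≤ 1 * Real.exp (-(c₃ ^ m * X ^ (2 * (k + 1) * m))) :=
              mul_le_mul_of_nonneg_right
                (mul_exp_neg_le_one (mul_nonneg hcA0 (pow_nonneg hX0 _))) (Real.exp_pos _).le
          _ = Real.exp (-(c₃ ^ m * X ^ (2 * (k + 1) * m))) := one_mul _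
          _ ≤ Real.exp (-((1 + (E : ℝ) +
                ((mvlen (-(MvPolynomial.C te * S)) : ℤ) : ℝ)) ^ m)) :=
              Real.exp_le_exp.mpr (neg_le_neg hYm)

end AnchorsMain

end HyperCell

end Summit.Schanuel.Schanuel.Theorems.RootDecomp1KHyper
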